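import Literature.Barriers.RiemannHypothesis.MollifierLimitationsProofs
import HarnessLib

/-!
# Radziwiłł 2012, Proposition B (Soundararajan): decomposition into its two printed halves

Sibling of `Literature/Barriers/RiemannHypothesis/MollifierLimitationsProofs.lean`, which vendors
**Proposition B** of M. Radziwiłł, *Limitations to mollifying `ζ(s)`* (arXiv:1207.6583), as the
named fact `Literature.Barriers.RiemannHypothesis.Radziwill2012_propB`: for `0 < θ < 1/2` and every
Dirichlet-polynomial mollifier `M_θ(s) = ∑_{n ≤ T^θ} a(n) n^{-s}`, `a(1) = 1`, `a(n) ≪ n^ε`,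
`𝓘(M_θ) = T⁻¹ ∫_T^{2T} |1 − ζ(½+it) M_θ(½+it)|² dt ≥ 1/θ + o(1)`.

The printed statement (p. 3) is a chain of two relations,

  `𝓘(M_θ) ∼ ∑_{m,n ≤ T^θ} a(m)ā(n)/[m,n] · (log(T(m,n)²/(2πmn)) + 2 log 2 + 2γ − 1) − 1 ≥ 1/θ + o(1)`,

with two different sources: the first ("using an asymptotic formula for `𝓘`, due to
Balasubramanian, Conrey and Heath-Brown", p. 3) is the twisted second-moment asymptotic of
[BalasubramanianConreyHeathBrown1985] for `θ < 1/2` — in the form quoted in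
[BettinChandeeRadziwill2017, (1.2)]: `∫_T^{2T} |ζ(½+it)A(½+it)|² dt = T·𝒬_T(a) + o(T)` — combined
with `T⁻¹∫_T^{2T} ζ(½+it)M_θ(½+it) dt → a(1) = 1`; the second is Soundararajan's lower bound for the
quadratic form `𝒬_T(a)`, proved in §7 of the paper (Lemmas 9–14) from `a(1) = 1` alone, for every
`θ < 1`. This file vendors the deep input (the Balasubramanian–Conrey–Heath-Brown asymptotic) and
the second half as named facts, with the source's numbering, and PROVES that the two halves give
`Radziwill2012_propB`; the first half is stated here only as the spelled-out hypothesis of that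
deduction and is DERIVED from the deep input in the sibling
`MollifierLimitationsPropBAsymptoticProofs.lean` (`Radziwill2012_propB_asymptotic_of_BCH`: the
twisted first moment and the expansion `|1 − ζM|² = 1 − 2Re ζM + |ζM|²`, proved), while the second half is
DISCHARGED in `MollifierLimitationsPropBQuadFormProofs.lean` (`Radziwill2012_propB_quadForm_holds`).
Net: Proposition B rests on the single named fact `BalasubramanianConreyHeathBrown1985_meanSquare`
(`Radziwill2012_propB_of_BCH` in that file).

* `bchQuadForm T N a` — the quadratic form
  `𝒬_T(a) = ∑_{m,n ≤ N} a(m)ā(n)/[m,n] · (log(T(m,n)²/(2πmn)) + 2 log 2 + 2γ − 1)` (real, the form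
  being Hermitian), glue over Mathlib (`Nat.gcd`, `Nat.lcm`, `Real.eulerMascheroniConstant`);
* `BalasubramanianConreyHeathBrown1985_meanSquare` — NAMED FACT, the twisted second moment
  `T⁻¹∫_T^{2T} |ζ(½+it)A(½+it)|² dt = 𝒬_T(a) + o(1)` for `θ < 1/2`, as quoted in
  [BettinChandeeRadziwill2017, (1.2)] (remainder as quoted in [Yu2023, §1]) — the deep input, NOT
  proved here (the original is not held; acquisition requested);
* the first relation — for `0 < θ < 1/2`, `𝓘(M_θ) = 𝒬_T(a) − 1 + o(1)` uniformly over the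
  admissible coefficients [Radziwill2012, Prop. B] — is NOT a named fact (D-0026 review,
  2026-08-15: it is the previous fact plus the elementary first moment
  `T⁻¹∫_T^{2T} ζ(½+it)M_θ(½+it) dt = a(1) + o(1)`); it appears below only spelled out, as the
  hypothesis `hA` of `Radziwill2012_propB_of_parts`, and is the theorem
  `Radziwill2012_propB_asymptotic_of_BCH` of `MollifierLimitationsPropBAsymptoticProofs.lean`;
* `Radziwill2012_propB_quadForm` — NAMED FACT, the second relation (§7): for `0 < θ < 1`,
  `𝒬_T(a) ≥ 1 + 1/θ + o(1)` uniformly over all `a : ℕ → ℂ` with `a(1) = 1` [Radziwill2012, §7,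
  Lemmas 9–14] — elementary (Möbius inversion, Cauchy–Schwarz, Mertens' first theorem and
  `∑_{n ≤ N} μ²(n)/φ(n) = log N + O(1)`), discharged in
  `MollifierLimitationsPropBQuadFormProofs.lean`;
* `Radziwill2012_propB_of_parts` — PROVED: the two relations imply `Radziwill2012_propB`.

## Reading of the printed statements (design notes)

* "`𝓘(M_θ) ∼ 𝒬_T(a) − 1`" is read additively and uniformly over the admissible class, exactly as
  the two cited inputs deliver it and as §7 uses it ("we thus obtain the desired lower bound
  `1 + 1/θ + o(1)`", p. 12, from which Prop. B is read off): for every `ε > 0` and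
  `T ≥ T₀(θ, C, ε)`, `|𝓘(M_θ) − (𝒬_T(a) − 1)| ≤ ε` for all `a` with `a(1) = 1`, `|a(n)| ≤ C(ε')n^{ε'}`.
  (BCH's remainder is `≪ N²T^{ε'} + T log^{-c} T` before division by `T`, as quoted in
  [Yu2023, §1]; for `N = T^θ`, `θ < 1/2` this is `o(T)`, with constants depending on `θ`, `c` and
  the implied constants of `a(n) ≪ n^ε` only.) Since `𝒬_T(a) − 1 ≥ 1/θ + o(1) > 0`,
  the additive form implies the printed `∼`.
* "`≥ 1/θ + o(1)`" in the second relation: §7 proves `𝒬_T(a) ≥ 1 + 1/θ + o(1)` for `N = T^θ`,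
  `θ < 1` ("Take `N = T^θ` with `θ < 1`", p. 12), the `o(1)` depending on `θ` only: the proof uses
  `a` only through `a(1) = 1` (Möbius inversion `1 = ∑_{ℓ ≤ N} y(ℓ)μ(ℓ)/ℓ`, p. 12), so no growth
  condition on `a` is needed and none is imposed in `Radziwill2012_propB_quadForm`. We take
  `N = ⌊T^θ⌋` as in `Radziwill2012_propB` (so `∑_{m,n ≤ T^θ}` is `∑_{m,n ≤ N}`).
* `𝒬_T(a)` is real: the kernel `(log(T(m,n)²/(2πmn)) + 2log 2 + 2γ − 1)/[m,n]` is real and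
  symmetric, so the imaginary parts of `a(m)ā(n)` cancel in pairs; we define `bchQuadForm` directly
  as the real number `∑_{m,n} Re(a(m)ā(n)) · kernel(m,n)`.

## References

* [Radziwill2012] M. Radziwiłł, *Limitations to mollifying ζ(s)*, arXiv:1207.6583 (2012): Prop. B
  (p. 3), §7 "Proof of Proposition B" (pp. 12–14: the quadratic form (7.1), Lemma 9, Lemma 10 and
  the deduction "Adding the equations … we obtain the desired lower bound `1 + 1/θ + o(1)`",
  Lemmas 11–14).
* [BalasubramanianConreyHeathBrown1985] R. Balasubramanian, J. B. Conrey, D. R. Heath-Brown,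
  *Asymptotic mean square of the product of the Riemann zeta-function and a Dirichlet polynomial*,
  J. reine angew. Math. 357 (1985), 161–181 (not held — acquisition requested 2026-08-15; quoted
  through the next two items).
* [BettinChandeeRadziwill2017] S. Bettin, V. Chandee, M. Radziwiłł, *The mean square of the product
  of the Riemann zeta-function with Dirichlet polynomials*, J. reine angew. Math. 729 (2017) =
  arXiv:1411.7764, §1 eq. (1.2) (p. 2): "For `θ < 1/2` and `φ(t)` the indicator function of the
  interval `[1, 2]`, they show that
  `I = T ∑_{d,e ≤ T^θ} (ā_d a_e/[d,e]) (log(T(d,e)²/(2πde)) + 2γ + log 4 − 1) + o(T)`."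
* [Yu2023] J. Yu, *The mean square of the product of the Riemann zeta-function and a Dirichlet
  polynomial in the critical strip*, arXiv:2312.10614, §1 (BCH's theorem with its remainder
  `E(T,A;½) ≪ M²T^ε + T log^{-c} T`, "under the condition `log M ≪ log T`").
-/

noncomputable section

open Complex MeasureTheory Real Finset
open scoped ComplexConjugate

namespace Literature.Barriers.RiemannHypothesis

/-! ## The quadratic form of Proposition B -/

/-- The Balasubramanian–Conrey–Heath-Brown quadratic form in Radziwiłł's normalisation
(mean over `[T, 2T]`):
`𝒬_T(a) = ∑_{m,n ≤ N} a(m)ā(n)/[m,n] · (log(T(m,n)²/(2πmn)) + 2 log 2 + 2γ − 1)`, a real number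
(the kernel is real symmetric, so only `Re(a(m)ā(n))` survives). For `N = ⌊T^θ⌋`, `θ < 1/2`, it is
the main term of `T⁻¹∫_T^{2T} |ζ(½+it) M(½+it)|² dt`, `M(s) = ∑_{n ≤ N} a(n)n^{-s}`.
[cite: Radziwill2012, Proposition B] [cite: BettinChandeeRadziwill2017, (1.2)] -/
def bchQuadForm (T : ℝ) (N : ℕ) (a : ℕ → ℂ) : ℝ :=
  ∑ m ∈ Icc 1 N, ∑ n ∈ Icc 1 N,
    (a m * conj (a n)).re / (Nat.lcm m n : ℝ) *
      (Real.log (T * (Nat.gcd m n : ℝ) ^ 2 / (2 * π * m * n)) + 2 * Real.log 2 +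
        2 * Real.eulerMascheroniConstant - 1)

/-! ## The Balasubramanian–Conrey–Heath-Brown asymptotic (the deep input) -/

/-- **Balasubramanian–Conrey–Heath-Brown 1985: the twisted second moment of `ζ` for `θ < 1/2`**,
in the form quoted by Bettin–Chandee–Radziwiłł, (1.2): for `A(s) = ∑_{n ≤ T^θ} a_n n^{-s}`,
`a_n ≪ n^ε`, "for `θ < 1/2` and `φ(t)` the indicator function of the interval `[1, 2]`, they show
that `I = ∫|ζ(½+it)|²|A(½+it)|²φ(t/T) dt =
T ∑_{d,e ≤ T^θ} (ā_d a_e/[d,e]) (log(T(d,e)²/(2πde)) + 2γ + log 4 − 1) + o(T)`" (BCH's own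
remainder, for `∫_0^T`, is `≪ N²T^{ε'} + T log^{-c} T`, any `c > 0`, as quoted in [Yu2023, §1]).
Vendored after division by `T`, with the `o(1)` uniform over the admissible class (its constants
depend on `θ`, `c` and the implied constants `C` of `a_n ≪ n^ε` only): for `0 < θ < 1/2`, every
`C` and every `ε > 0` there is `T₀` with
`|T⁻¹∫_T^{2T} |ζ(½+it)A(½+it)|² dt − 𝒬_T(a)| ≤ ε` for all `T ≥ T₀` and all `a` with
`|a(n)| ≤ C(δ)n^δ` (`δ > 0`, `n ≥ 1`), `N = ⌊T^θ⌋`. NOT proved here. The original is not held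
(acquisition requested); the statement is vendored from the two quoting sources.
[cite: BettinChandeeRadziwill2017, (1.2)] [cite: Yu2023, §1]
[cite: BalasubramanianConreyHeathBrown1985, Theorem (as quoted)] -/
def BalasubramanianConreyHeathBrown1985_meanSquare : Prop :=
  ∀ θ : ℝ, 0 < θ → θ < 1 / 2 → ∀ C : ℝ → ℝ, ∀ ε : ℝ, 0 < ε →
    ∃ T₀ : ℝ, ∀ T : ℝ, T₀ ≤ T →
      ∀ a : ℕ → ℂ,
        (∀ δ : ℝ, 0 < δ → ∀ n : ℕ, 1 ≤ n → ‖a n‖ ≤ C δ * (n : ℝ) ^ δ) →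
          |T⁻¹ * (∫ t in T..(2 * T),
              ‖riemannZeta (1 / 2 + t * I) * dirichletMollifier a ⌊T ^ θ⌋₊ (1 / 2 + t * I)‖ ^ 2) -
            bchQuadForm T ⌊T ^ θ⌋₊ a| ≤ ε

/-! ## The second half of Proposition B, as a named fact -/

/-- **Radziwiłł 2012, Proposition B, second relation (Soundararajan; §7, Lemmas 9–14).**
"`∑_{m,n ≤ T^θ} a(m)ā(n)/[m,n] · (log(T(m,n)²/(2πmn)) + 2log 2 + 2γ − 1) − 1 ≥ 1/θ + o(1)`", proved
in §7 for `N = T^θ` with any `θ < 1` ("The sum of squares is non-negative, and `1 − θ − ε > 0`; we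
thus obtain the desired lower bound `1 + 1/θ + o(1)`", p. 12) using the coefficients only through
`a(1) = 1` (Möbius inversion, `1 = ∑_{ℓ ≤ N} y(ℓ)μ(ℓ)/ℓ`). Vendored: for `0 < θ < 1` and `ε > 0`
there is `T₀` such that `𝒬_T(a) ≥ 1 + 1/θ − ε` for all `T ≥ T₀` and all `a : ℕ → ℂ` with
`a(1) = 1`, where `N = ⌊T^θ⌋`. [cite: Radziwill2012, §7 (Lemmas 9–14)] -/
def Radziwill2012_propB_quadForm : Prop :=
  ∀ θ : ℝ, 0 < θ → θ < 1 → ∀ ε : ℝ, 0 < ε →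
    ∃ T₀ : ℝ, ∀ T : ℝ, T₀ ≤ T →
      ∀ a : ℕ → ℂ, a 1 = 1 → 1 + 1 / θ - ε ≤ bchQuadForm T ⌊T ^ θ⌋₊ a

/-! ## Proposition B from its two halves -/

/-- **Deduction of Proposition B** (Radziwiłł 2012, Prop. B = first relation + §7): the first
relation `𝓘(M_θ) = 𝒬_T(a) − 1 + o(1)` (`θ < 1/2`; "using an asymptotic formula for `𝓘`, due to
Balasubramanian, Conrey and Heath-Brown", p. 3 — spelled out as the hypothesis `hA`: for
`0 < θ < 1/2`, every family of implied constants `C` and every `ε > 0` there is `T₀` with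
`|𝓘(M_θ) − (𝒬_T(a) − 1)| ≤ ε` for all `T ≥ T₀` and all `a` with `a(1) = 1`, `|a(n)| ≤ C(δ)n^δ`;
supplied from `BalasubramanianConreyHeathBrown1985_meanSquare` by
`Radziwill2012_propB_asymptotic_of_BCH` in `MollifierLimitationsPropBAsymptoticProofs.lean`) and
Soundararajan's bound `𝒬_T(a) ≥ 1 + 1/θ + o(1)` (`hQ`) give `𝓘(M_θ) ≥ 1/θ + o(1)`, i.e.
`Radziwill2012_propB`. [cite: Radziwill2012, Proposition B and §7] -/
theorem Radziwill2012_propB_of_parts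
    (hA : ∀ θ : ℝ, 0 < θ → θ < 1 / 2 → ∀ C : ℝ → ℝ, ∀ ε : ℝ, 0 < ε →
      ∃ T₀ : ℝ, ∀ T : ℝ, T₀ ≤ T →
        ∀ a : ℕ → ℂ, a 1 = 1 →
          (∀ δ : ℝ, 0 < δ → ∀ n : ℕ, 1 ≤ n → ‖a n‖ ≤ C δ * (n : ℝ) ^ δ) →
            |mollificationDefect (dirichletMollifier a ⌊T ^ θ⌋₊) T -
                (bchQuadForm T ⌊T ^ θ⌋₊ a - 1)| ≤ ε)
    (hQ : Radziwill2012_propB_quadForm) : Radziwill2012_propB := by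
  intro θ hθ hθ2 C ε hε
  have hε2 : 0 < ε / 2 := by linarith
  obtain ⟨T₁, hT₁⟩ := hA θ hθ hθ2 C (ε / 2) hε2
  obtain ⟨T₂, hT₂⟩ := hQ θ hθ (by linarith) (ε / 2) hε2
  refine ⟨max T₁ T₂, fun T hT a ha1 ha ↦ ?_⟩
  have h1 := hT₁ T (le_trans (le_max_left _ _) hT) a ha1 ha
  have h2 := hT₂ T (le_trans (le_max_right _ _) hT) a ha1
  have h3 := (abs_le.1 h1).1
  linarith

end Literature.Barriers.RiemannHypothesis
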